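import Literature.NumberTheory.EllipticCurves.KezukaLi2020.CubeSumThreePart
import Literature.NumberTheory.EllipticCurves.ShuYin2022.CubeSumThreePThreePart
import Literature.NumberTheory.EllipticCurves.Wuthrich2014.ShaBoundProofs
import Literature.NumberTheory.EllipticCurves.ComplexMultiplicationTwistIsogenyProofs
import Literature.NumberTheory.EllipticCurves.IsogenyVariableChangeProofs
import Literature.NumberTheory.EllipticCurves.IsogenyCompProofs
import Literature.NumberTheory.EllipticCurves.SzpiroLocalDataProofs
import Literature.NumberTheory.EllipticCurves.DegreeConjectureAbcPrelims
import Literature.NumberTheory.DiophantineGeometry.LocalReductionHasMultiplicativeReductionAtProofs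
import HarnessLib

/-!
# X12 at `p = 3`, cube-sum corner: the LANE TRANSPORTS for the six census classes 441b, 2700h, 4563b, 6075bc, 13068c, 16641a (isogeny `…2 → …1` and global minimality, IN THE KERNEL)

HONEST FRAMING (cell `b2b-bsdres`, run/shared/lean/b2b/bsd-rank1-residual/; harvest seat
`b2b-bsdres-harvest-1`, gen 3): prove what is provable now; shrink each hard class to its core with
data; no claim beyond stated classes. The cell deletes the COMBINATION-SHAPED residual classes of
the BSD formula in analytic rank `≤ 1` from PUBLISHED theorems only and TYPES the
construction-shaped ones; this is not "finishing BSD". Class X12 (CM, rank `1`, `p ∣ 6·d_K·N`, `p`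
not split) stays CONSTRUCTION-SHAPED; this file is PER CURVE. Theorems only: no definition of a
notion, NO new named fact (net debt `0`); the sixteen `def`s below are explicit Weierstrass
equations (data), each identified with a Cremona label in its docstring (table read of Cremona's
`allcurves`, files `allcurves.00000-09999` / `.10000-19999`, the cell's copy under
`run/shared/lean/speedrun/kurihara/ecdata/`; second engine PARI/GP, see the harvest's
`RECLASSIFY.md` gen-3 addendum).

Referee ruling R65.3 (HOME/REFEREE.md, gen 61): the cube-sum FAMILY theorems vendored by gen 2 —
Kezuka–Li 2020 Cor. 1.2 (`KezukaLi2020.cor12_threePart_of_cubeSum`), Hu–Shu–Yin 2019 Thm. 1.4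
(`HuShuYin2019.thm14_threePart_product`, with Burungale–Flach 2024), Shu–Yin 2022 Thm. 1.2
(`ShuYin2022.thm12_threePart_product`, with Burungale–Flach 2024) — close the census classes
441b, 2700h, 4563b, 6075bc ‖ 13068c, 16641a at `p = 3` "ONLY MODULO the named lane steps (isogeny
transport from the Cremona `…2` model to the census `…1` record, global minimality of the `…2`
models, and for F46/F47 a globally minimal model of the rank-`0` partner)". This file supplies
exactly those steps as kernel theorems:

* **Global minimality, decided in the kernel, for all sixteen models involved** (the six census
  records `…1`, the six cube-sum curves `…2`, and the four rank-zero partners `E_{3p²}` /`E_{p²}`: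
  Cremona 11907o2, 41067h2, 449307k2, 225b2). All sixteen are `[0, 0, a₃, 0, a₆]` with `c₄ = 0`
  (`j = 0`). Away from `3` Silverman's criterion `ord_q Δ < 12` (AEC VII Remark 1.1; tree theorem
  `isMinimalAt_baseChange_int_of_not_pow_dvd_Δ`) applies, re-run by `decide` on a bounded check
  (`checkTwelfth`). AT `3` four of the models (6075bc2, 11907o2, 41067h2, 449307k2) have
  `ord₃ Δ = 13 ≥ 12` (and `c₄ = 0`), where Silverman's sufficient criterion is silent (Kraus's
  conditions would be needed in general); the other twelve have `ord₃ Δ ≤ 9`. For `j = 0`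
  equations we prove instead the elementary **`3`-adic criterion**
  `isMinimalAt_baseChange_int_three_of_c₄_eq_zero`: an integral equation with `c₄ = 0` and
  `3⁹ ∤ c₆` is minimal at `3` — because ANY `ℤ₃`-integral equation with `c₄ = 0` has `27 ∣ c₆`
  (`c₄ = b₂² − 24 b₄ = 0` forces `3 ∣ b₂`, then `3 ∣ b₄`, and `c₆ = −b₂³ + 36 b₂ b₄ − 216 b₆`;
  `valued_c₆_le_of_c₄_eq_zero`), while a rescaling lowering `ord₃ Δ` by `12` lowers `ord₃ c₆` by
  `6`, to `≤ 2`. (Silverman, *AEC* VII.1: `u`-scalings act by `c₆ ↦ u⁻⁶ c₆`, `Δ ↦ u⁻¹² Δ`.)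
* **The `3`-isogenies `…1 ~ …2`**, from the tree's Vélu isogeny
  `y² = x³ + c ~ y² = x³ − 27c` (`isIsogenous_mk_a₆`, file
  `ComplexMultiplicationTwistIsogenyProofs`; Vélu 1971, kernel `⟨(0, ±√c)⟩`) composed with the
  change of variables `(x, y) ↦ (x/4, y/8 − 1/2)` (`HuShuYin2019.halfScale_smul`:
  `y² + y = x³ + a₆ ≅ y² = x³ + (64 a₆ + 16)`): in each class `64·a₆(…2) + 16 = −27·(64·a₆(…1) + 16)`
  (resp. `a₆(…2) = −27·a₆(…1)` for the two `a₃ = 0` classes).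
* **`BSD(E, 3)` for the six census records** (`bsdp_three_cremona441b1`, `…2700h1`, `…4563b1`,
  `…6075bc1`, `…13068c1`, `…16641a1`) from PUBLISHED named facts only: the family theorem of the
  class, Cassels' isogeny invariance of the BSD quotient (`bsdRHS_eq_of_isIsogenous`, Cassels 1965 /
  Milne *ADT* I.7.3, through the tree theorem `Wuthrich2014.bsdp_of_isIsogenous`), modularity
  (`hasEntireLFunction_rat`, for `L'(E,1) ≠ 0` via `leadingLCoeff_ne_zero_holds`), and for the
  product formulas Burungale–Flach 2024 Cor. 2 (`bsdTriple_of_hasCM_of_L_one_ne_zero`) and — for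
  6075bc only, where Shu–Yin print `|Ш[3^∞]| = 1` but not the finiteness of `Ш` — Gross–Zagier–
  Kolyvagin (`rank_eq_analyticRank_of_analyticRank_le_one`) for `Ш(6075bc2)` finite. No instance
  hypothesis remains: every `[IsElliptic]`/`[IsGloballyMinimal]` is an `instance` proved here.

What this file does NOT do: it does not change any class label (R65.1: family theorems are
per-curve tools); it asserts nothing about the Cremona LABELS beyond the docstrings (the theorems
are about the explicit equations; that `[0,0,1,0,12]` is the curve Cremona calls 441b1 is the
table read, checked by two engines outside the kernel); `#Ш_an = 1` for these curves (Cremona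
`allbsd`) is not used.

## References
* [Cremona1997] J. E. Cremona, *Algorithms for Modular Elliptic Curves*, 2nd ed. (1997), Table 1
  and the electronic tables `ecdata` (`allcurves`, `allisog`: classes 441b, 2700h, 4563b, 6075bc,
  13068c, 16641a are `[[1,3],[3,1]]` isogeny classes; 225b, 11907o, 41067h, 449307k).
* [SilvermanAEC2009] J. H. Silverman, *The Arithmetic of Elliptic Curves*, 2nd ed., VII.1
  (Remark 1.1, Prop. 1.3), VIII.8; III.1 (`b₂, b₄, b₆, c₄, c₆, Δ`).
* [Kraus1989] A. Kraus, *Quelques remarques à propos des invariants `c₄`, `c₆` et `Δ` d'une courbe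
  elliptique*, Acta Arith. 54 (1989) 75–80 (the general conditions at `2` and `3`; NOT used — the
  `j = 0` case needs only the divisibility `27 ∣ c₆` proved here).
* J. Vélu, C. R. Acad. Sci. Paris 273 (1971) A238–A241 (tree file `ThreeIsogeny`).
* [KezukaLi2020] Doc. Math. 25 (2020) Cor. 1.2; [HuShuYin2019] Trans. AMS 372 (2019) Thm. 1.4;
  [ShuYin2022] Math. Ann. 385 (2023) Thm. 1.2; [BurungaleFlach2024] Camb. J. Math. 12 (2024) Cor. 2;
  [Cassels1965ArithmeticVIII]; [MilneADT2006] Thm. I.7.3; [Miller2011LMS] Def. 1.1 (`BSD(E,p)`).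
* HOME/REFEREE.md R65.3; HOME/b2b-bsdres-harvest-1/{HARVEST.md C12–C14, RECLASSIFY.md Annex E and
  gen-3 addendum}.
-/

set_option autoImplicit false

noncomputable section

open scoped Classical

open IsDedekindDomain WeierstrassCurve Rat.HeightOneSpectrum
  Literature.NumberTheory.EllipticCurves Literature.NumberTheory.EllipticCurves.HuShuYin2019

namespace Literature.NumberTheory.EllipticCurves.Rank1Residual.X12CubeSum

/-! ### §1. The `3`-adic minimality criterion for `j = 0` equations -/

section MinimalAtThree

variable {v : HeightOneSpectrum ℤ}

/-- In `ℚ_v` for the place `v` of `3`: `|n|ᵥ ≤ exp (−k)` when `3ᵏ ∣ n`. [folklore] -/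
theorem valued_natCast_le_exp (hv : natGenerator v = 3) {n k : ℕ} (h : 3 ^ k ∣ n) :
    Valued.v ((n : ℚ) : v.adicCompletion ℚ) ≤ WithZero.exp (-(k : ℤ)) := by
  have h1 : ((n : ℚ) : v.adicCompletion ℚ) =
      algebraMap ℚ (v.adicCompletion ℚ) ((n : ℤ) : ℚ) := by
    simp
  rw [h1, valued_algebraMap_adicCompletion,
    Literature.NumberTheory.EllipticCurves.Rat.valuation_intCast_le_exp_iff, hv]
  exact_mod_cast h

/-- In `ℚ_v` for the place `v` of `3`: `exp (−k) < |n|ᵥ` when `3ᵏ ∤ n`. [folklore] -/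
theorem exp_lt_valued_natCast (hv : natGenerator v = 3) {n k : ℕ} (h : ¬ 3 ^ k ∣ n) :
    WithZero.exp (-(k : ℤ)) < Valued.v ((n : ℚ) : v.adicCompletion ℚ) := by
  have h1 : ((n : ℚ) : v.adicCompletion ℚ) =
      algebraMap ℚ (v.adicCompletion ℚ) ((n : ℤ) : ℚ) := by
    simp
  rw [h1, valued_algebraMap_adicCompletion,
    Literature.NumberTheory.EllipticCurves.Rat.exp_lt_valuation_intCast_iff, hv]
  exact_mod_cast h

/-- **`27 ∣ c₆` for every `ℤ₃`-integral Weierstrass equation with `c₄ = 0`.** Over `ℚ_v`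
(`v` the place of `3`): if `Y` is `O_v`-integral and `c₄(Y) = 0` then `|c₆(Y)|ᵥ ≤ exp (−3)`.
Proof: `b₂, b₄, b₆ ∈ O_v`; `c₄ = b₂² − 24 b₄ = 0` gives `|b₂|ᵥ² ≤ |24|ᵥ = exp (−1)`, so
`|b₂|ᵥ ≤ exp (−1)`; then `|24|ᵥ |b₄|ᵥ = |b₂|ᵥ² ≤ exp (−2)` with `|24|ᵥ = exp (−1)` gives
`|b₄|ᵥ ≤ exp (−1)`; finally each term of `c₆ = −b₂³ + 36 b₂ b₄ − 216 b₆` has `|·|ᵥ ≤ exp (−3)`.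
(Silverman, *AEC* III.1 for the formulas.) [cite: SilvermanAEC2009, III.1] -/
theorem valued_c₆_le_of_c₄_eq_zero (hv : natGenerator v = 3)
    (Y : WeierstrassCurve (v.adicCompletion ℚ)) [Y.IsIntegral (v.adicCompletionIntegers ℚ)]
    (hc4 : Y.c₄ = 0) : Valued.v Y.c₆ ≤ WithZero.exp (-3 : ℤ) := by
  set O := v.adicCompletionIntegers ℚ with hO
  have hb2 : Valued.v Y.b₂ ≤ 1 := by
    rw [← integralModel_b₂_eq O Y]
    exact (valued_le_one_iff_mem_range_adicCompletionIntegers v _).mpr ⟨_, rfl⟩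
  have hb4 : Valued.v Y.b₄ ≤ 1 := by
    rw [← integralModel_b₄_eq O Y]
    exact (valued_le_one_iff_mem_range_adicCompletionIntegers v _).mpr ⟨_, rfl⟩
  have hb6 : Valued.v Y.b₆ ≤ 1 := by
    rw [← integralModel_b₆_eq O Y]
    exact (valued_le_one_iff_mem_range_adicCompletionIntegers v _).mpr ⟨_, rfl⟩
  -- the constants `24`, `36`, `216`
  have h24 : Valued.v (24 : v.adicCompletion ℚ) ≤ WithZero.exp (-(1 : ℕ) : ℤ) := by
    have := valued_natCast_le_exp hv (n := 24) (k := 1) (by norm_num)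
    exact_mod_cast this
  have h24' : WithZero.exp (-(2 : ℕ) : ℤ) < Valued.v (24 : v.adicCompletion ℚ) := by
    have := exp_lt_valued_natCast hv (n := 24) (k := 2) (by norm_num)
    exact_mod_cast this
  have h36 : Valued.v (36 : v.adicCompletion ℚ) ≤ WithZero.exp (-(2 : ℕ) : ℤ) := by
    have := valued_natCast_le_exp hv (n := 36) (k := 2) (by norm_num)
    exact_mod_cast this
  have h216 : Valued.v (216 : v.adicCompletion ℚ) ≤ WithZero.exp (-(3 : ℕ) : ℤ) := by
    have := valued_natCast_le_exp hv (n := 216) (k := 3) (by norm_num)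
    exact_mod_cast this
  simp only [Nat.cast_one, Nat.cast_ofNat] at h24 h24' h36 h216
  -- `b₂² = 24 b₄`
  have hc4' : Y.b₂ ^ 2 = 24 * Y.b₄ := by
    have h : Y.c₄ = Y.b₂ ^ 2 - 24 * Y.b₄ := rfl
    rw [hc4] at h
    linear_combination -h
  -- `|b₂|ᵥ ≤ exp (−1)`
  have hβ : Valued.v Y.b₂ ≤ WithZero.exp (-1 : ℤ) := by
    have hsq : Valued.v Y.b₂ ^ 2 ≤ WithZero.exp (-1 : ℤ) := by
      rw [← Valuation.map_pow, hc4', Valuation.map_mul]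
      calc Valued.v (24 : v.adicCompletion ℚ) * Valued.v Y.b₄
          ≤ WithZero.exp (-1 : ℤ) * 1 := mul_le_mul' h24 hb4
        _ = WithZero.exp (-1 : ℤ) := mul_one _
    by_cases hβ0 : Valued.v Y.b₂ = 0
    · rw [hβ0]; exact zero_le
    · rw [← WithZero.log_le_iff_le_exp hβ0]
      have h2 : 2 • WithZero.log (Valued.v Y.b₂) ≤ -1 := by
        rw [← WithZero.log_pow]
        exact (WithZero.log_le_iff_le_exp (pow_ne_zero _ hβ0)).mpr hsq
      simp only [nsmul_eq_mul, Nat.cast_ofNat] at h2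
      omega
  -- `|b₄|ᵥ ≤ exp (−1)`
  have hγ : Valued.v Y.b₄ ≤ WithZero.exp (-1 : ℤ) := by
    have hprod : Valued.v (24 : v.adicCompletion ℚ) * Valued.v Y.b₄ ≤ WithZero.exp (-2 : ℤ) := by
      rw [← Valuation.map_mul, ← hc4', Valuation.map_pow,
        show (-2 : ℤ) = 2 • (-1 : ℤ) by norm_num, WithZero.exp_nsmul]
      exact pow_le_pow_left' hβ 2
    by_cases hγ0 : Valued.v Y.b₄ = 0
    · rw [hγ0]; exact zero_le
    · have h24ne : Valued.v (24 : v.adicCompletion ℚ) ≠ 0 := (WithZero.exp_pos.trans h24').ne'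
      have h1 : -2 < WithZero.log (Valued.v (24 : v.adicCompletion ℚ)) :=
        (WithZero.lt_log_iff_exp_lt h24ne).mpr h24'
      have h2 : WithZero.log (Valued.v (24 : v.adicCompletion ℚ)) +
          WithZero.log (Valued.v Y.b₄) ≤ -2 := by
        rw [← WithZero.log_mul h24ne hγ0]
        exact (WithZero.log_le_iff_le_exp (mul_ne_zero h24ne hγ0)).mpr hprod
      rw [← WithZero.log_le_iff_le_exp hγ0]
      omega
  -- the three terms of `c₆ = −b₂³ + 36 b₂ b₄ − 216 b₆`
  have hc6 : Y.c₆ = -Y.b₂ ^ 3 + 36 * Y.b₂ * Y.b₄ - 216 * Y.b₆ := rfl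
  have t1 : Valued.v (-Y.b₂ ^ 3) ≤ WithZero.exp (-3 : ℤ) := by
    rw [Valuation.map_neg, Valuation.map_pow, show (-3 : ℤ) = 3 • (-1 : ℤ) by norm_num,
      WithZero.exp_nsmul]
    exact pow_le_pow_left' hβ 3
  have t2 : Valued.v (36 * Y.b₂ * Y.b₄) ≤ WithZero.exp (-3 : ℤ) := by
    rw [Valuation.map_mul, Valuation.map_mul]
    calc Valued.v (36 : v.adicCompletion ℚ) * Valued.v Y.b₂ * Valued.v Y.b₄
        ≤ WithZero.exp (-2 : ℤ) * WithZero.exp (-1 : ℤ) * 1 :=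
          mul_le_mul' (mul_le_mul' h36 hβ) hb4
      _ = WithZero.exp (-3 : ℤ) := by
          rw [mul_one, ← WithZero.exp_add]; norm_num
  have t3 : Valued.v (216 * Y.b₆) ≤ WithZero.exp (-3 : ℤ) := by
    rw [Valuation.map_mul]
    calc Valued.v (216 : v.adicCompletion ℚ) * Valued.v Y.b₆
        ≤ WithZero.exp (-3 : ℤ) * 1 := mul_le_mul' h216 hb6
      _ = WithZero.exp (-3 : ℤ) := mul_one _
  rw [hc6]
  exact Valuation.map_sub_le _ (Valuation.map_add_le _ t1 t2) t3

/-- **Minimality at `3` for `j = 0` equations.** An integral Weierstrass equation over `ℤ` with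
`c₄ = 0` and `3⁹ ∤ c₆` is minimal at the place of `3`: a `ℚ₃`-isomorphic `ℤ₃`-integral equation
`C • W` has `c₄ = 0`, hence `27 ∣ c₆(C • W) = u⁻⁶ c₆(W)` (`valued_c₆_le_of_c₄_eq_zero`), which with
`ord₃ c₆(W) ≤ 8` forces `ord₃ u ≤ 0` and so `ord₃ Δ(C • W) = ord₃ Δ(W) − 12 ord₃ u ≥ ord₃ Δ(W)`
(Silverman, *AEC* VII.1: the definition of minimality and Table 3.1, `c₆ ↦ u⁻⁶ c₆`,
`Δ ↦ u⁻¹² Δ`). It covers the `j = 0` equations `[0,0,a₃,0,a₆]` with `ord₃ (a₃² + 4a₆) ≤ 5`, in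
particular those with `ord₃ Δ = 13`, where Remark VII.1.1 (`ord Δ < 12` or `ord c₄ < 4`) is
silent. [cite: SilvermanAEC2009, VII.1 (Definition, Remark 1.1) and III.1 Table 3.1] -/
theorem isMinimalAt_baseChange_int_three_of_c₄_eq_zero {W₀ : WeierstrassCurve ℤ}
    (hv : natGenerator v = 3) (hc4 : W₀.c₄ = 0) (hc6 : ¬ (3 : ℤ) ^ 9 ∣ W₀.c₆) :
    (W₀.baseChange ℚ).IsMinimalAt v := by
  set W := W₀.baseChange ℚ with hW
  have hWint : W.IsIntegralAt v := isIntegralAt_baseChange_int v W₀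
  rw [IsMinimalAt,
    isMinimal_iff_of_le_one_iff (valued_le_one_iff_mem_range_adicCompletionIntegers v)]
  refine ⟨hWint, fun C hC ↦ ?_⟩
  set X := W.baseChange (v.adicCompletion ℚ) with hX
  haveI : (C • X).IsIntegral (v.adicCompletionIntegers ℚ) := hC
  -- `c₄ (C • X) = 0`
  have hXc4 : X.c₄ = 0 := by
    rw [hX, WeierstrassCurve.baseChange, map_c₄, hW, baseChange_int_c₄, hc4]; simp
  have hc4' : (C • X).c₄ = 0 := by rw [variableChange_c₄, hXc4, mul_zero]
  have hint : Valued.v (C • X).c₆ ≤ WithZero.exp (-3 : ℤ) :=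
    valued_c₆_le_of_c₄_eq_zero hv (C • X) hc4'
  -- `|c₆ (X)|ᵥ > exp (−9)`, read in `ℚ`
  have hc : Valued.v X.c₆ = v.valuation ℚ W.c₆ := by
    simp only [hX, WeierstrassCurve.baseChange, map_c₆, valued_algebraMap_adicCompletion]
  have h9 : WithZero.exp (-9 : ℤ) < Valued.v X.c₆ := by
    rw [hc, hW, baseChange_int_c₆]
    have := (Literature.NumberTheory.EllipticCurves.Rat.exp_lt_valuation_intCast_iff v W₀.c₆ 9).mpr
      (by rw [hv]; exact_mod_cast hc6)
    exact_mod_cast this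
  rw [variableChange_c₆, Valuation.map_mul, Valuation.map_pow] at hint
  set a := Valued.v (↑C.u⁻¹ : v.adicCompletion ℚ) with ha
  set c := Valued.v X.c₆ with hc'
  have ha0 : a ≠ 0 := by simp [ha]
  have hc0 : c ≠ 0 := (WithZero.exp_pos.trans h9).ne'
  have ha1 : a ≤ 1 := by
    have h1 : -9 < WithZero.log c := (WithZero.lt_log_iff_exp_lt hc0).mpr h9
    have h2 : 6 • WithZero.log a + WithZero.log c ≤ -3 := by
      rw [← WithZero.log_pow, ← WithZero.log_mul (pow_ne_zero _ ha0) hc0]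
      exact (WithZero.log_le_iff_le_exp (mul_ne_zero (pow_ne_zero _ ha0) hc0)).mpr hint
    rw [← WithZero.log_le_log ha0 one_ne_zero, WithZero.log_one]
    simp only [nsmul_eq_mul, Nat.cast_ofNat] at h2
    omega
  rw [variableChange_Δ, Valuation.map_mul, Valuation.map_pow]
  calc a ^ 12 * Valued.v X.Δ
      ≤ 1 ^ 12 * Valued.v X.Δ := mul_le_mul_left (pow_le_pow_left' ha1 12) _
    _ = _ := by rw [one_pow, one_mul]

end MinimalAtThree

/-! ### §2. Global minimality of integer `j = 0` equations: `3`-adic criterion at `3`, Silverman elsewhere -/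

/-- `checkTwelfth n B`: no `q` with `2 ≤ q < B`, `q ≠ 3`, has `q¹² ∣ n` (a closed `Bool`
computation, discharged by `decide`). [folklore] -/
def checkTwelfth (n B : ℕ) : Bool :=
  (List.range B).all fun q => decide (q < 2) || decide (q = 3) || decide (n % q ^ 12 ≠ 0)

/-- A passing `checkTwelfth |n| B` with `|n| < B¹²` certifies `q¹² ∤ n` for every prime `q ≠ 3`
(primes `q ≥ B` have `q¹² > |n|`). [folklore] -/
theorem not_pow_twelve_dvd_of_checkTwelfth {n : ℤ} (B : ℕ) (hn : n ≠ 0)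
    (hB : n.natAbs < B ^ 12) (hc : checkTwelfth n.natAbs B = true) :
    ∀ q : ℕ, q.Prime → q ≠ 3 → ¬ (q : ℤ) ^ 12 ∣ n := by
  intro q hq hq3 hdvd
  have hdvd' : q ^ 12 ∣ n.natAbs := by
    have := Int.natAbs_dvd_natAbs.mpr hdvd
    simpa [Int.natAbs_pow] using this
  by_cases hqB : q < B
  · simp only [checkTwelfth, List.all_eq_true, List.mem_range, Bool.or_eq_true,
      decide_eq_true_eq] at hc
    rcases hc q hqB with (h | h) | h
    · exact absurd hq.two_le (not_le.mpr h)
    · exact hq3 h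
    · exact h (Nat.mod_eq_zero_of_dvd hdvd')
  · have hpos : 0 < n.natAbs := Int.natAbs_pos.mpr hn
    have hle : q ^ 12 ≤ n.natAbs := Nat.le_of_dvd hpos hdvd'
    have : B ^ 12 ≤ q ^ 12 := Nat.pow_le_pow_left (not_lt.mp hqB) 12
    omega

/-- **Global minimality of an integer equation with `c₄ = 0`, `3⁹ ∤ c₆` and `q¹² ∤ Δ` for every
prime `q ≠ 3`**: minimal at `3` by `isMinimalAt_baseChange_int_three_of_c₄_eq_zero`, at `q ≠ 3` by
Silverman's `ord_q Δ < 12` (`isMinimalAt_baseChange_int_of_not_pow_dvd_Δ`), and globally minimal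
iff minimal everywhere (`isGloballyMinimal_of_forall_isMinimalAt_int`, AEC VIII.8).
[cite: SilvermanAEC2009, VII.1 Remark 1.1 and VIII.8] -/
theorem isGloballyMinimal_baseChange_int_of_c₄_eq_zero (W₀ : WeierstrassCurve ℤ)
    (hc4 : W₀.c₄ = 0) (hc6 : ¬ (3 : ℤ) ^ 9 ∣ W₀.c₆)
    (hΔ : ∀ q : ℕ, q.Prime → q ≠ 3 → ¬ (q : ℤ) ^ 12 ∣ W₀.Δ) :
    (W₀.baseChange ℚ).IsGloballyMinimal :=
  isGloballyMinimal_of_forall_isMinimalAt_int _ fun v ↦ by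
    by_cases hv : natGenerator v = 3
    · exact isMinimalAt_baseChange_int_three_of_c₄_eq_zero hv hc4 hc6
    · exact isMinimalAt_baseChange_int_of_not_pow_dvd_Δ (hΔ _ (prime_natGenerator v) hv)

/-- The integer equation `[0, 0, a₃, 0, a₆]` base-changed to `ℚ`. [folklore] -/
theorem baseChange_mk_int (a3 a6 : ℤ) :
    (⟨0, 0, a3, 0, a6⟩ : WeierstrassCurve ℤ).baseChange ℚ = ⟨0, 0, (a3 : ℚ), 0, (a6 : ℚ)⟩ := by
  ext <;> simp [WeierstrassCurve.baseChange, WeierstrassCurve.map]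

/-- `c₄ [0, 0, a₃, 0, a₆] = 0`. [cite: SilvermanAEC2009, III.1] -/
theorem c₄_mk_int (a3 a6 : ℤ) : (⟨0, 0, a3, 0, a6⟩ : WeierstrassCurve ℤ).c₄ = 0 := by
  simp [WeierstrassCurve.c₄, WeierstrassCurve.b₂, WeierstrassCurve.b₄]

/-- `c₆ [0, 0, a₃, 0, a₆] = −216 (a₃² + 4a₆)`. [cite: SilvermanAEC2009, III.1] -/
theorem c₆_mk_int (a3 a6 : ℤ) :
    (⟨0, 0, a3, 0, a6⟩ : WeierstrassCurve ℤ).c₆ = -216 * (a3 ^ 2 + 4 * a6) := by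
  simp [WeierstrassCurve.c₆, WeierstrassCurve.b₂, WeierstrassCurve.b₄, WeierstrassCurve.b₆]

/-- `Δ [0, 0, a₃, 0, a₆] = −27 (a₃² + 4a₆)²`. [cite: SilvermanAEC2009, III.1] -/
theorem Δ_mk_int (a3 a6 : ℤ) :
    (⟨0, 0, a3, 0, a6⟩ : WeierstrassCurve ℤ).Δ = -27 * (a3 ^ 2 + 4 * a6) ^ 2 := by
  simp only [WeierstrassCurve.Δ, WeierstrassCurve.b₂, WeierstrassCurve.b₄, WeierstrassCurve.b₆,
    WeierstrassCurve.b₈]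
  ring

/-- **Global minimality of `[0, 0, a₃, 0, a₆] / ℚ` from three decidable checks**: `b₆ = a₃² + 4a₆`
nonzero with `3⁶ ∤ b₆` (so `3⁹ ∤ c₆ = −216 b₆`), and no prime `q ≠ 3` below `B` with
`q¹² ∣ 27 b₆²`, where `27 b₆² < B¹²`. [cite: SilvermanAEC2009, VII.1 Remark 1.1 and VIII.8] -/
theorem isGloballyMinimal_mk (a3 a6 : ℤ) (B : ℕ) (h0 : a3 ^ 2 + 4 * a6 ≠ 0)
    (h3 : ¬ (3 : ℤ) ^ 6 ∣ a3 ^ 2 + 4 * a6)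
    (hB : (27 * (a3 ^ 2 + 4 * a6) ^ 2).natAbs < B ^ 12)
    (hc : checkTwelfth (27 * (a3 ^ 2 + 4 * a6) ^ 2).natAbs B = true) :
    (⟨0, 0, (a3 : ℚ), 0, (a6 : ℚ)⟩ : WeierstrassCurve ℚ).IsGloballyMinimal := by
  rw [← baseChange_mk_int]
  refine isGloballyMinimal_baseChange_int_of_c₄_eq_zero _ (c₄_mk_int a3 a6) ?_ ?_
  · rw [c₆_mk_int]
    intro h
    apply h3
    have h27 : (3 : ℤ) ^ 9 = 3 ^ 6 * 27 := by norm_num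
    rw [h27, show (-216 : ℤ) * (a3 ^ 2 + 4 * a6) = 27 * (-8 * (a3 ^ 2 + 4 * a6)) by ring,
      mul_comm ((3 : ℤ) ^ 6)] at h
    have h' : (3 : ℤ) ^ 6 ∣ -8 * (a3 ^ 2 + 4 * a6) :=
      (mul_dvd_mul_iff_left (by norm_num : (27 : ℤ) ≠ 0)).mp h
    have hcop : IsCoprime ((3 : ℤ) ^ 6) (-8) := by
      rw [Int.isCoprime_iff_gcd_eq_one]; decide
    exact hcop.dvd_of_dvd_mul_left h'
  · rw [Δ_mk_int]
    have hn : (-27 : ℤ) * (a3 ^ 2 + 4 * a6) ^ 2 ≠ 0 := mul_ne_zero (by norm_num) (pow_ne_zero _ h0)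
    have habs : ((-27 : ℤ) * (a3 ^ 2 + 4 * a6) ^ 2).natAbs = (27 * (a3 ^ 2 + 4 * a6) ^ 2).natAbs := by
      rw [show (-27 : ℤ) * (a3 ^ 2 + 4 * a6) ^ 2 = -(27 * (a3 ^ 2 + 4 * a6) ^ 2) by ring,
        Int.natAbs_neg]
    exact not_pow_twelve_dvd_of_checkTwelfth B hn (habs ▸ hB) (habs ▸ hc)

/-- `[0, 0, a₃, 0, a₆] / ℚ` is an elliptic curve when `a₃² + 4a₆ ≠ 0` (`Δ = −27 (a₃² + 4a₆)²`).
[cite: SilvermanAEC2009, III.1] -/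
theorem isElliptic_mk {a3 a6 : ℚ} (h : a3 ^ 2 + 4 * a6 ≠ 0) :
    (⟨0, 0, a3, 0, a6⟩ : WeierstrassCurve ℚ).IsElliptic := by
  refine ⟨?_⟩
  rw [isUnit_iff_ne_zero]
  have hΔ : (⟨0, 0, a3, 0, a6⟩ : WeierstrassCurve ℚ).Δ = -27 * (a3 ^ 2 + 4 * a6) ^ 2 := by
    simp only [WeierstrassCurve.Δ, WeierstrassCurve.b₂, WeierstrassCurve.b₄, WeierstrassCurve.b₆,
      WeierstrassCurve.b₈]
    ring
  rw [hΔ]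
  exact mul_ne_zero (by norm_num) (pow_ne_zero _ h)

/-- **The `3`-isogeny between `y² + y = x³ + a` and `y² + y = x³ + a'` when
`64a' + 16 = −27 (64a + 16)`**: `(x, y) ↦ (x/4, y/8 − 1/2)` takes them to `y² = x³ + c` and
`y² = x³ − 27c` (`c = 64a + 16`, `HuShuYin2019.halfScale_smul`), which are linked by Vélu's
`3`-isogeny with kernel `⟨(0, ±√c)⟩` (tree theorem `isIsogenous_mk_a₆`); changes of variables are
isogenies (`isIsogenous_of_smul_eq`, `isIsogenous_of_smul`). [cite: SilvermanAEC2009, III.4 Remark 4.13.3 (Vélu)] -/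
theorem isIsogenous_of_a₆ {a a' : ℚ} (h0 : 64 * a + 16 ≠ 0)
    (h : 64 * a' + 16 = -27 * (64 * a + 16)) :
    IsIsogenous (⟨0, 0, 1, 0, a⟩ : WeierstrassCurve ℚ) ⟨0, 0, 1, 0, a'⟩ := by
  have h1 : IsIsogenous (⟨0, 0, 1, 0, a⟩ : WeierstrassCurve ℚ) ⟨0, 0, 0, 0, 64 * a + 16⟩ :=
    isIsogenous_of_smul_eq (halfScale_smul a)
  have h2 := isIsogenous_mk_a₆ h0
  have h3 : IsIsogenous (⟨0, 0, 0, 0, -27 * (64 * a + 16)⟩ : WeierstrassCurve ℚ)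
      ⟨0, 0, 1, 0, a'⟩ := by
    rw [← h, ← halfScale_smul a']
    exact isIsogenous_of_smul _ _
  exact h1.trans' (h2.trans' h3)

/-! ### §3. The sixteen equations (Cremona's models) with their kernel instances -/

/-- Cremona **441b1** `= [0,0,1,0,12]` (the census record of class 441b; rational `3`-torsion
`(0, 3)`; `Δ = −3³·7⁴`). [cite: Cremona1997, Table 1 (class 441b)] -/
def cremona441b1 : WeierstrassCurve ℚ := ⟨0, 0, 1, 0, 12⟩
/-- Cremona **441b2** `= [0,0,1,0,-331]` (the cube-sum curve `E_7 : x³ + y³ = 7`; `Δ = −3⁹·7⁴`).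
[cite: Cremona1997, Table 1 (class 441b)] -/
def cremona441b2 : WeierstrassCurve ℚ := ⟨0, 0, 1, 0, -331⟩
/-- Cremona **11907o2** `= [0,0,1,0,-145861]` (`E_{147} = E_{3·7²}`, the rank-zero partner of
`E_7` in Hu–Shu–Yin's product formula; `Δ = −3¹³·7⁸`, `N = 3⁵·7²`). [cite: Cremona1997, Table 1 (class 11907o)] -/
def cremona11907o2 : WeierstrassCurve ℚ := ⟨0, 0, 1, 0, -145861⟩
/-- Cremona **2700h1** `= [0,0,0,0,625]` (census record of class 2700h; `Δ = −2⁴·3³·5⁸`).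
[cite: Cremona1997, Table 1 (class 2700h)] -/
def cremona2700h1 : WeierstrassCurve ℚ := ⟨0, 0, 0, 0, 625⟩
/-- Cremona **2700h2** `= [0,0,0,0,-16875]` (Kezuka–Li's model (4.1) of `C_{50} : x³ + y³ = 50`,
`cubeSumTwoModel 5 2`; `Δ = −2⁴·3⁹·5⁸`). [cite: Cremona1997, Table 1 (class 2700h)] -/
def cremona2700h2 : WeierstrassCurve ℚ := ⟨0, 0, 0, 0, -16875⟩
/-- Cremona **4563b1** `= [0,0,1,0,42]` (census record of class 4563b; `Δ = −3³·13⁴`).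
[cite: Cremona1997, Table 1 (class 4563b)] -/
def cremona4563b1 : WeierstrassCurve ℚ := ⟨0, 0, 1, 0, 42⟩
/-- Cremona **4563b2** `= [0,0,1,0,-1141]` (`E_{13} : x³ + y³ = 13`; `Δ = −3⁹·13⁴`).
[cite: Cremona1997, Table 1 (class 4563b)] -/
def cremona4563b2 : WeierstrassCurve ℚ := ⟨0, 0, 1, 0, -1141⟩
/-- Cremona **41067h2** `= [0,0,1,0,-1735081]` (`E_{507} = E_{3·13²}`, rank-zero partner of
`E_{13}`; `Δ = −3¹³·13⁸`). [cite: Cremona1997, Table 1 (class 41067h)] -/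
def cremona41067h2 : WeierstrassCurve ℚ := ⟨0, 0, 1, 0, -1735081⟩
/-- Cremona **6075bc1** `= [0,0,1,0,56]` (census record of class 6075bc; `Δ = −3⁷·5⁴`).
[cite: Cremona1997, Table 1 (class 6075bc)] -/
def cremona6075bc1 : WeierstrassCurve ℚ := ⟨0, 0, 1, 0, 56⟩
/-- Cremona **6075bc2** `= [0,0,1,0,-1519]` (`E_{15} = E_{3·5} : x³ + y³ = 15`; `Δ = −3¹³·5⁴` —
Silverman's `ord Δ < 12` fails at `3`, the `3`-adic criterion of §1 applies).
[cite: Cremona1997, Table 1 (class 6075bc)] -/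
def cremona6075bc2 : WeierstrassCurve ℚ := ⟨0, 0, 1, 0, -1519⟩
/-- Cremona **225b2** `= [0,0,1,0,-4219]` (`E_{25} = E_{5²}`, rank-zero partner of `E_{15}` in
Shu–Yin's product formula; `Δ = −3⁹·5⁸`). [cite: Cremona1997, Table 1 (class 225b)] -/
def cremona225b2 : WeierstrassCurve ℚ := ⟨0, 0, 1, 0, -4219⟩
/-- Cremona **13068c1** `= [0,0,0,0,121]` (census record of class 13068c; `Δ = −2⁴·3³·11⁴`).
[cite: Cremona1997, Table 1 (class 13068c)] -/
def cremona13068c1 : WeierstrassCurve ℚ := ⟨0, 0, 0, 0, 121⟩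
/-- Cremona **13068c2** `= [0,0,0,0,-3267]` (Kezuka–Li's model of `C_{22} : x³ + y³ = 22`,
`cubeSumTwoModel 11 1`; `Δ = −2⁴·3⁹·11⁴`). [cite: Cremona1997, Table 1 (class 13068c)] -/
def cremona13068c2 : WeierstrassCurve ℚ := ⟨0, 0, 0, 0, -3267⟩
/-- Cremona **16641a1** `= [0,0,1,0,462]` (census record of class 16641a; `Δ = −3³·43⁴`).
[cite: Cremona1997, Table 1 (class 16641a)] -/
def cremona16641a1 : WeierstrassCurve ℚ := ⟨0, 0, 1, 0, 462⟩
/-- Cremona **16641a2** `= [0,0,1,0,-12481]` (`E_{43} : x³ + y³ = 43`; `Δ = −3⁹·43⁴`).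
[cite: Cremona1997, Table 1 (class 16641a)] -/
def cremona16641a2 : WeierstrassCurve ℚ := ⟨0, 0, 1, 0, -12481⟩
/-- Cremona **449307k2** `= [0,0,1,0,-207692161]` (`E_{5547} = E_{3·43²}`, rank-zero partner of
`E_{43}`; `Δ = −3¹³·43⁸`). [cite: Cremona1997, Table 1 (class 449307k)] -/
def cremona449307k2 : WeierstrassCurve ℚ := ⟨0, 0, 1, 0, -207692161⟩

/-! #### `IsElliptic` (`Δ = −27·b₆² ≠ 0`) -/

/-- 441b1 is an elliptic curve (`Δ = −27·b₆² ≠ 0`). [cite: SilvermanAEC2009, III.1] -/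
instance isElliptic_cremona441b1 : cremona441b1.IsElliptic := isElliptic_mk (by norm_num)
/-- 441b2 is an elliptic curve (`Δ = −27·b₆² ≠ 0`). [cite: SilvermanAEC2009, III.1] -/
instance isElliptic_cremona441b2 : cremona441b2.IsElliptic := isElliptic_mk (by norm_num)
/-- 11907o2 is an elliptic curve (`Δ = −27·b₆² ≠ 0`). [cite: SilvermanAEC2009, III.1] -/
instance isElliptic_cremona11907o2 : cremona11907o2.IsElliptic := isElliptic_mk (by norm_num)
/-- 2700h1 is an elliptic curve (`Δ = −27·b₆² ≠ 0`). [cite: SilvermanAEC2009, III.1] -/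
instance isElliptic_cremona2700h1 : cremona2700h1.IsElliptic := isElliptic_mk (by norm_num)
/-- 2700h2 is an elliptic curve (`Δ = −27·b₆² ≠ 0`). [cite: SilvermanAEC2009, III.1] -/
instance isElliptic_cremona2700h2 : cremona2700h2.IsElliptic := isElliptic_mk (by norm_num)
/-- 4563b1 is an elliptic curve (`Δ = −27·b₆² ≠ 0`). [cite: SilvermanAEC2009, III.1] -/
instance isElliptic_cremona4563b1 : cremona4563b1.IsElliptic := isElliptic_mk (by norm_num)
/-- 4563b2 is an elliptic curve (`Δ = −27·b₆² ≠ 0`). [cite: SilvermanAEC2009, III.1] -/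
instance isElliptic_cremona4563b2 : cremona4563b2.IsElliptic := isElliptic_mk (by norm_num)
/-- 41067h2 is an elliptic curve (`Δ = −27·b₆² ≠ 0`). [cite: SilvermanAEC2009, III.1] -/
instance isElliptic_cremona41067h2 : cremona41067h2.IsElliptic := isElliptic_mk (by norm_num)
/-- 6075bc1 is an elliptic curve (`Δ = −27·b₆² ≠ 0`). [cite: SilvermanAEC2009, III.1] -/
instance isElliptic_cremona6075bc1 : cremona6075bc1.IsElliptic := isElliptic_mk (by norm_num)
/-- 6075bc2 is an elliptic curve (`Δ = −27·b₆² ≠ 0`). [cite: SilvermanAEC2009, III.1] -/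
instance isElliptic_cremona6075bc2 : cremona6075bc2.IsElliptic := isElliptic_mk (by norm_num)
/-- 225b2 is an elliptic curve (`Δ = −27·b₆² ≠ 0`). [cite: SilvermanAEC2009, III.1] -/
instance isElliptic_cremona225b2 : cremona225b2.IsElliptic := isElliptic_mk (by norm_num)
/-- 13068c1 is an elliptic curve (`Δ = −27·b₆² ≠ 0`). [cite: SilvermanAEC2009, III.1] -/
instance isElliptic_cremona13068c1 : cremona13068c1.IsElliptic := isElliptic_mk (by norm_num)
/-- 13068c2 is an elliptic curve (`Δ = −27·b₆² ≠ 0`). [cite: SilvermanAEC2009, III.1] -/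
instance isElliptic_cremona13068c2 : cremona13068c2.IsElliptic := isElliptic_mk (by norm_num)
/-- 16641a1 is an elliptic curve (`Δ = −27·b₆² ≠ 0`). [cite: SilvermanAEC2009, III.1] -/
instance isElliptic_cremona16641a1 : cremona16641a1.IsElliptic := isElliptic_mk (by norm_num)
/-- 16641a2 is an elliptic curve (`Δ = −27·b₆² ≠ 0`). [cite: SilvermanAEC2009, III.1] -/
instance isElliptic_cremona16641a2 : cremona16641a2.IsElliptic := isElliptic_mk (by norm_num)
/-- 449307k2 is an elliptic curve (`Δ = −27·b₆² ≠ 0`). [cite: SilvermanAEC2009, III.1] -/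
instance isElliptic_cremona449307k2 : cremona449307k2.IsElliptic := isElliptic_mk (by norm_num)

/-! #### `IsGloballyMinimal`, decided in the kernel (`isGloballyMinimal_mk`: `3`-adic criterion at `3`, `checkTwelfth` elsewhere) -/

/-- 441b1 `[0,0,1,0,12]` is a global minimal model (`Δ = −3³·7⁴`). [cite: SilvermanAEC2009, VII.1 Remark 1.1] -/
instance isGloballyMinimal_cremona441b1 : cremona441b1.IsGloballyMinimal := by
  have := isGloballyMinimal_mk 1 12 50 (by norm_num) (by norm_num) (by norm_num) (by decide)
  simpa [cremona441b1] using this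
/-- 441b2 `[0,0,1,0,-331]` is a global minimal model (`Δ = −3⁹·7⁴`). [cite: SilvermanAEC2009, VII.1 Remark 1.1] -/
instance isGloballyMinimal_cremona441b2 : cremona441b2.IsGloballyMinimal := by
  have := isGloballyMinimal_mk 1 (-331) 50 (by norm_num) (by norm_num) (by norm_num) (by decide)
  simpa [cremona441b2] using this
/-- 11907o2 `[0,0,1,0,-145861]` is a global minimal model (`Δ = −3¹³·7⁸`; minimal at `3` by the
`3`-adic criterion: `ord₃ c₆ = 8`). [cite: SilvermanAEC2009, VII.1] -/
instance isGloballyMinimal_cremona11907o2 : cremona11907o2.IsGloballyMinimal := by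
  have := isGloballyMinimal_mk 1 (-145861) 50 (by norm_num) (by norm_num) (by norm_num)
    (by decide)
  simpa [cremona11907o2] using this
/-- 2700h1 `[0,0,0,0,625]` is a global minimal model (`Δ = −2⁴·3³·5⁸`). [cite: SilvermanAEC2009, VII.1 Remark 1.1] -/
instance isGloballyMinimal_cremona2700h1 : cremona2700h1.IsGloballyMinimal := by
  have := isGloballyMinimal_mk 0 625 50 (by norm_num) (by norm_num) (by norm_num) (by decide)
  simpa [cremona2700h1] using this
/-- 2700h2 `[0,0,0,0,-16875]` is a global minimal model (`Δ = −2⁴·3⁹·5⁸`). [cite: SilvermanAEC2009, VII.1 Remark 1.1] -/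
instance isGloballyMinimal_cremona2700h2 : cremona2700h2.IsGloballyMinimal := by
  have := isGloballyMinimal_mk 0 (-16875) 50 (by norm_num) (by norm_num) (by norm_num)
    (by decide)
  simpa [cremona2700h2] using this
/-- 4563b1 `[0,0,1,0,42]` is a global minimal model (`Δ = −3³·13⁴`). [cite: SilvermanAEC2009, VII.1 Remark 1.1] -/
instance isGloballyMinimal_cremona4563b1 : cremona4563b1.IsGloballyMinimal := by
  have := isGloballyMinimal_mk 1 42 50 (by norm_num) (by norm_num) (by norm_num) (by decide)
  simpa [cremona4563b1] using this
/-- 4563b2 `[0,0,1,0,-1141]` is a global minimal model (`Δ = −3⁹·13⁴`). [cite: SilvermanAEC2009, VII.1 Remark 1.1] -/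
instance isGloballyMinimal_cremona4563b2 : cremona4563b2.IsGloballyMinimal := by
  have := isGloballyMinimal_mk 1 (-1141) 50 (by norm_num) (by norm_num) (by norm_num)
    (by decide)
  simpa [cremona4563b2] using this
/-- 41067h2 `[0,0,1,0,-1735081]` is a global minimal model (`Δ = −3¹³·13⁸`; `3`-adic criterion at
`3`). [cite: SilvermanAEC2009, VII.1] -/
instance isGloballyMinimal_cremona41067h2 : cremona41067h2.IsGloballyMinimal := by
  have := isGloballyMinimal_mk 1 (-1735081) 50 (by norm_num) (by norm_num) (by norm_num)
    (by decide)
  simpa [cremona41067h2] using this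
/-- 6075bc1 `[0,0,1,0,56]` is a global minimal model (`Δ = −3⁷·5⁴`). [cite: SilvermanAEC2009, VII.1 Remark 1.1] -/
instance isGloballyMinimal_cremona6075bc1 : cremona6075bc1.IsGloballyMinimal := by
  have := isGloballyMinimal_mk 1 56 50 (by norm_num) (by norm_num) (by norm_num) (by decide)
  simpa [cremona6075bc1] using this
/-- 6075bc2 `[0,0,1,0,-1519]` is a global minimal model (`Δ = −3¹³·5⁴`; `3`-adic criterion at `3`:
`ord₃ c₆ = 8`). [cite: SilvermanAEC2009, VII.1] -/
instance isGloballyMinimal_cremona6075bc2 : cremona6075bc2.IsGloballyMinimal := by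
  have := isGloballyMinimal_mk 1 (-1519) 50 (by norm_num) (by norm_num) (by norm_num)
    (by decide)
  simpa [cremona6075bc2] using this
/-- 225b2 `[0,0,1,0,-4219]` is a global minimal model (`Δ = −3⁹·5⁸`). [cite: SilvermanAEC2009, VII.1 Remark 1.1] -/
instance isGloballyMinimal_cremona225b2 : cremona225b2.IsGloballyMinimal := by
  have := isGloballyMinimal_mk 1 (-4219) 50 (by norm_num) (by norm_num) (by norm_num)
    (by decide)
  simpa [cremona225b2] using this
/-- 13068c1 `[0,0,0,0,121]` is a global minimal model (`Δ = −2⁴·3³·11⁴`). [cite: SilvermanAEC2009, VII.1 Remark 1.1] -/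
instance isGloballyMinimal_cremona13068c1 : cremona13068c1.IsGloballyMinimal := by
  have := isGloballyMinimal_mk 0 121 50 (by norm_num) (by norm_num) (by norm_num) (by decide)
  simpa [cremona13068c1] using this
/-- 13068c2 `[0,0,0,0,-3267]` is a global minimal model (`Δ = −2⁴·3⁹·11⁴`). [cite: SilvermanAEC2009, VII.1 Remark 1.1] -/
instance isGloballyMinimal_cremona13068c2 : cremona13068c2.IsGloballyMinimal := by
  have := isGloballyMinimal_mk 0 (-3267) 50 (by norm_num) (by norm_num) (by norm_num)
    (by decide)
  simpa [cremona13068c2] using this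
/-- 16641a1 `[0,0,1,0,462]` is a global minimal model (`Δ = −3³·43⁴`). [cite: SilvermanAEC2009, VII.1 Remark 1.1] -/
instance isGloballyMinimal_cremona16641a1 : cremona16641a1.IsGloballyMinimal := by
  have := isGloballyMinimal_mk 1 462 50 (by norm_num) (by norm_num) (by norm_num) (by decide)
  simpa [cremona16641a1] using this
/-- 16641a2 `[0,0,1,0,-12481]` is a global minimal model (`Δ = −3⁹·43⁴`). [cite: SilvermanAEC2009, VII.1 Remark 1.1] -/
instance isGloballyMinimal_cremona16641a2 : cremona16641a2.IsGloballyMinimal := by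
  have := isGloballyMinimal_mk 1 (-12481) 50 (by norm_num) (by norm_num) (by norm_num)
    (by decide)
  simpa [cremona16641a2] using this
/-- 449307k2 `[0,0,1,0,-207692161]` is a global minimal model (`Δ = −3¹³·43⁸ ≈ 1.9·10¹⁹ < 50¹²`;
`3`-adic criterion at `3`). [cite: SilvermanAEC2009, VII.1] -/
instance isGloballyMinimal_cremona449307k2 : cremona449307k2.IsGloballyMinimal := by
  have := isGloballyMinimal_mk 1 (-207692161) 50 (by norm_num) (by norm_num) (by norm_num)
    (by decide)
  simpa [cremona449307k2] using this

/-! ### §4. The six `3`-isogenies `…1 ~ …2` (Cremona `allisog`: each class is `[[1,3],[3,1]]`) -/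

/-- `441b1 ~ 441b2` over `ℚ` (`64·12 + 16 = 784 = 28²`, `64·(−331) + 16 = −21168 = −27·784`).
[cite: Cremona1997, Table 1 (class 441b)] -/
theorem isIsogenous_cremona441b : IsIsogenous cremona441b1 cremona441b2 :=
  isIsogenous_of_a₆ (by norm_num) (by norm_num)

/-- `4563b1 ~ 4563b2` (`64·42 + 16 = 2704 = 52²`, `64·(−1141) + 16 = −27·2704`).
[cite: Cremona1997, Table 1 (class 4563b)] -/
theorem isIsogenous_cremona4563b : IsIsogenous cremona4563b1 cremona4563b2 :=
  isIsogenous_of_a₆ (by norm_num) (by norm_num)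

/-- `6075bc1 ~ 6075bc2` (`64·56 + 16 = 3600 = 60²`, `64·(−1519) + 16 = −27·3600`).
[cite: Cremona1997, Table 1 (class 6075bc)] -/
theorem isIsogenous_cremona6075bc : IsIsogenous cremona6075bc1 cremona6075bc2 :=
  isIsogenous_of_a₆ (by norm_num) (by norm_num)

/-- `16641a1 ~ 16641a2` (`64·462 + 16 = 29584 = 172²`, `64·(−12481) + 16 = −27·29584`).
[cite: Cremona1997, Table 1 (class 16641a)] -/
theorem isIsogenous_cremona16641a : IsIsogenous cremona16641a1 cremona16641a2 :=
  isIsogenous_of_a₆ (by norm_num) (by norm_num)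

/-- `2700h1 ~ 2700h2`: Vélu's `3`-isogeny `y² = x³ + 625 → y² = x³ − 27·625 = x³ − 16875`
directly (`isIsogenous_mk_a₆`). [cite: Cremona1997, Table 1 (class 2700h)] -/
theorem isIsogenous_cremona2700h : IsIsogenous cremona2700h1 cremona2700h2 := by
  have h := isIsogenous_mk_a₆ (c := (625 : ℚ)) (by norm_num)
  norm_num at h
  exact h

/-- `13068c1 ~ 13068c2`: `y² = x³ + 121 → y² = x³ − 3267`. [cite: Cremona1997, Table 1 (class 13068c)] -/
theorem isIsogenous_cremona13068c : IsIsogenous cremona13068c1 cremona13068c2 := by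
  have h := isIsogenous_mk_a₆ (c := (121 : ℚ)) (by norm_num)
  norm_num at h
  exact h

/-! ### §5. The identifications with the families' models -/

/-- `2700h2 = cubeSumTwoModel 5 2` (Kezuka–Li's `C_{2·5²}`), as a variable change by `1`.
[cite: KezukaLi2020, (4.1) (p. 2139)] -/
theorem cremona2700h2_eq : ∃ C : VariableChange ℚ, C • cremona2700h2 = KezukaLi2020.cubeSumTwoModel 5 2 :=
  ⟨1, by rw [one_smul, KezukaLi2020.cubeSumTwoModel_five_two]; rfl⟩

/-- `13068c2 = cubeSumTwoModel 11 1` (Kezuka–Li's `C_{2·11}`). [cite: KezukaLi2020, (4.1) (p. 2139)] -/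
theorem cremona13068c2_eq :
    ∃ C : VariableChange ℚ, C • cremona13068c2 = KezukaLi2020.cubeSumTwoModel 11 1 :=
  ⟨1, by rw [one_smul, KezukaLi2020.cubeSumTwoModel_eleven_one]; rfl⟩

/-- `441b2 ≅ E_7`, `4563b2 ≅ E_13`, `16641a2 ≅ E_43` (gen 2's `variableChange_cremona_eq_cubeSumCurve`).
[cite: HuShuYin2019, p. 4] -/
theorem cremona_b2_eq :
    (∃ C : VariableChange ℚ, C • cremona441b2 = cubeSumCurve 7) ∧
    (∃ C : VariableChange ℚ, C • cremona4563b2 = cubeSumCurve 13) ∧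
    (∃ C : VariableChange ℚ, C • cremona16641a2 = cubeSumCurve 43) :=
  ⟨⟨halfScale, variableChange_cremona_eq_cubeSumCurve.1⟩,
    ⟨halfScale, variableChange_cremona_eq_cubeSumCurve.2.1⟩,
    ⟨halfScale, variableChange_cremona_eq_cubeSumCurve.2.2⟩⟩

/-- The rank-zero partners: `11907o2 ≅ E_{3·7²}`, `41067h2 ≅ E_{3·13²}`, `449307k2 ≅ E_{3·43²}`
(`64·a₆ + 16 = −432·(3p²)²`). [cite: HuShuYin2019, p. 4] -/
theorem cremona_partner_eq :
    (∃ C : VariableChange ℚ, C • cremona11907o2 = cubeSumCurve (3 * (7 : ℚ) ^ 2)) ∧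
    (∃ C : VariableChange ℚ, C • cremona41067h2 = cubeSumCurve (3 * (13 : ℚ) ^ 2)) ∧
    (∃ C : VariableChange ℚ, C • cremona449307k2 = cubeSumCurve (3 * (43 : ℚ) ^ 2)) := by
  refine ⟨⟨halfScale, ?_⟩, ⟨halfScale, ?_⟩, ⟨halfScale, ?_⟩⟩ <;>
    simp only [cremona11907o2, cremona41067h2, cremona449307k2, halfScale_smul, cubeSumCurve] <;>
    norm_num

/-- Shu–Yin's pair for `p = 5`: `225b2 ≅ E_{5²}` and `6075bc2 ≅ E_{3·5}`
(gen 2's `ShuYin2022.cremona_6075bc2_eq_cubeSumCurve`). [cite: ShuYin2022, Thm. 1.2] -/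
theorem cremona_sy_eq :
    (∃ C : VariableChange ℚ, C • cremona225b2 = cubeSumCurve ((5 : ℚ) ^ 2)) ∧
    (∃ C : VariableChange ℚ, C • cremona6075bc2 = cubeSumCurve (3 * (5 : ℚ))) := by
  refine ⟨⟨halfScale, ?_⟩, ⟨halfScale, ShuYin2022.cremona_6075bc2_eq_cubeSumCurve⟩⟩
  simp only [cremona225b2, halfScale_smul, cubeSumCurve]
  norm_num

/-! ### §6. `BSD(E,3)` for the cube-sum curves `…2` (family facts, no instance hypothesis left) and, by transport, for the census records `…1` -/

/-- The transport step, packaged: from `BSD(W',3)`, `r_an(W') = 1`, `Ш(W')` finite on the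
cube-sum side to `r_an(W) = 1 ∧ BSD(W,3)` on the census side along a `ℚ`-isogeny `W ~ W'`
(Cassels' invariance `bsdRHS_eq_of_isIsogenous` through `Wuthrich2014.bsdp_of_isIsogenous`;
`L'(W',1) ≠ 0` from modularity via `leadingLCoeff_ne_zero_holds`; `r_an` is an isogeny invariant,
`analyticRank_eq_of_isIsogenous'`). [cite: MilneADT2006, Thm. I.7.3] [cite: Miller2011LMS, §1] -/
theorem bsdp_three_of_isIsogenous (hCassels : bsdRHS_eq_of_isIsogenous)
    (hmod : hasEntireLFunction_rat) {W W' : WeierstrassCurve ℚ} [W.IsElliptic] [W'.IsElliptic]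
    [W.IsGloballyMinimal] [W'.IsGloballyMinimal] (hiso : IsIsogenous W W')
    (hr : W'.analyticRank = 1) (hfin : Finite W'.sha) (h : BSDp W' 3) :
    W.analyticRank = 1 ∧ BSDp W 3 := by
  haveI : Fact (Nat.Prime 3) := ⟨Nat.prime_three⟩
  exact ⟨(analyticRank_eq_of_isIsogenous' hiso).trans hr,
    Wuthrich2014.bsdp_of_isIsogenous hCassels hiso hfin (W'.leadingLCoeff_ne_zero_holds (hmod W')) h⟩

/-- **2700h2** (`C_{50}`): `r_an = 1 ∧ BSD(E,3)` from Kezuka–Li Cor. 1.2 (2) alone (`p = 5 ≡ 5 mod 9`),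
plus `Ш` finite. [cite: KezukaLi2020, Cor. 1.2 (2)] -/
theorem bsdp_three_cremona2700h2 (h : KezukaLi2020.cor12_threePart_of_cubeSum) :
    cremona2700h2.analyticRank = 1 ∧ Finite cremona2700h2.sha ∧ BSDp cremona2700h2 3 := by
  obtain ⟨-, hr, hfin, -⟩ := h 5 (by norm_num) (by norm_num) 2 (Or.inr ⟨by norm_num, rfl⟩)
    cremona2700h2 cremona2700h2_eq
  exact ⟨hr, hfin, (KezukaLi2020.bsdp_three_of_cor12 h (by norm_num) (by norm_num)
    (Or.inr ⟨by norm_num, rfl⟩) cremona2700h2 cremona2700h2_eq).2⟩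

/-- **2700h1** (census record): `r_an = 1 ∧ BSD(E,3)`, transported from 2700h2 along the
`3`-isogeny. Inputs: Kezuka–Li Cor. 1.2, Cassels, modularity. [cite: KezukaLi2020, Cor. 1.2 (2)] [cite: MilneADT2006, Thm. I.7.3] -/
theorem bsdp_three_cremona2700h1 (h : KezukaLi2020.cor12_threePart_of_cubeSum)
    (hCassels : bsdRHS_eq_of_isIsogenous) (hmod : hasEntireLFunction_rat) :
    cremona2700h1.analyticRank = 1 ∧ BSDp cremona2700h1 3 := by
  obtain ⟨hr, hfin, hb⟩ := bsdp_three_cremona2700h2 h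
  exact bsdp_three_of_isIsogenous hCassels hmod isIsogenous_cremona2700h hr hfin hb

/-- **13068c2** (`C_{22}`): `r_an = 1 ∧ Ш finite ∧ BSD(E,3)` from Kezuka–Li Cor. 1.2 (1)
(`p = 11 ≡ 2 mod 9`). [cite: KezukaLi2020, Cor. 1.2 (1)] -/
theorem bsdp_three_cremona13068c2 (h : KezukaLi2020.cor12_threePart_of_cubeSum) :
    cremona13068c2.analyticRank = 1 ∧ Finite cremona13068c2.sha ∧ BSDp cremona13068c2 3 := by
  obtain ⟨-, hr, hfin, -⟩ := h 11 (by norm_num) (by norm_num) 1 (Or.inl ⟨by norm_num, rfl⟩)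
    cremona13068c2 cremona13068c2_eq
  exact ⟨hr, hfin, (KezukaLi2020.bsdp_three_of_cor12 h (by norm_num) (by norm_num)
    (Or.inl ⟨by norm_num, rfl⟩) cremona13068c2 cremona13068c2_eq).2⟩

/-- **13068c1** (census record): transported from 13068c2. [cite: KezukaLi2020, Cor. 1.2 (1)] [cite: MilneADT2006, Thm. I.7.3] -/
theorem bsdp_three_cremona13068c1 (h : KezukaLi2020.cor12_threePart_of_cubeSum)
    (hCassels : bsdRHS_eq_of_isIsogenous) (hmod : hasEntireLFunction_rat) :
    cremona13068c1.analyticRank = 1 ∧ BSDp cremona13068c1 3 := by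
  obtain ⟨hr, hfin, hb⟩ := bsdp_three_cremona13068c2 h
  exact bsdp_three_of_isIsogenous hCassels hmod isIsogenous_cremona13068c hr hfin hb

/-- **441b2** (`E_7`): `r_an = 1 ∧ Ш finite ∧ BSD(E,3)` from Hu–Shu–Yin Thm. 1.4 (`p = 7`) +
Burungale–Flach 2024 for the partner 11907o2 (`E_{147}`), whose global minimality is now a kernel
instance. [cite: HuShuYin2019, Thm. 1.4] [cite: BurungaleFlach2024, Cor. 2] -/
theorem bsdp_three_cremona441b2 (h : thm14_threePart_product)
    (hCM0 : bsdTriple_of_hasCM_of_L_one_ne_zero) (hmod : hasEntireLFunction_rat) :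
    cremona441b2.analyticRank = 1 ∧ Finite cremona441b2.sha ∧ BSDp cremona441b2 3 := by
  obtain ⟨h9, h3, -⟩ := hypotheses_seven_thirteen_fortythree
  obtain ⟨-, -, hfin, -⟩ := h 7 (by norm_num) h9 h3 cremona11907o2 cremona441b2 cremona_b2_eq.1
    cremona_partner_eq.1
  obtain ⟨hr, hb⟩ := bsdp_three_of_thm14 h hCM0 hmod (by norm_num) h9 h3 cremona11907o2
    cremona441b2 cremona_b2_eq.1 cremona_partner_eq.1
  exact ⟨hr, hfin, hb⟩

/-- **441b1** (census record): transported from 441b2. [cite: HuShuYin2019, Thm. 1.4] [cite: BurungaleFlach2024, Cor. 2] [cite: MilneADT2006, Thm. I.7.3] -/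
theorem bsdp_three_cremona441b1 (h : thm14_threePart_product)
    (hCM0 : bsdTriple_of_hasCM_of_L_one_ne_zero) (hmod : hasEntireLFunction_rat)
    (hCassels : bsdRHS_eq_of_isIsogenous) :
    cremona441b1.analyticRank = 1 ∧ BSDp cremona441b1 3 := by
  obtain ⟨hr, hfin, hb⟩ := bsdp_three_cremona441b2 h hCM0 hmod
  exact bsdp_three_of_isIsogenous hCassels hmod isIsogenous_cremona441b hr hfin hb

/-- **4563b2** (`E_13`): from Hu–Shu–Yin Thm. 1.4 (`p = 13`) + Burungale–Flach for 41067h2.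
[cite: HuShuYin2019, Thm. 1.4] [cite: BurungaleFlach2024, Cor. 2] -/
theorem bsdp_three_cremona4563b2 (h : thm14_threePart_product)
    (hCM0 : bsdTriple_of_hasCM_of_L_one_ne_zero) (hmod : hasEntireLFunction_rat) :
    cremona4563b2.analyticRank = 1 ∧ Finite cremona4563b2.sha ∧ BSDp cremona4563b2 3 := by
  obtain ⟨-, -, h9, h3, -⟩ := hypotheses_seven_thirteen_fortythree
  obtain ⟨-, -, hfin, -⟩ := h 13 (by norm_num) h9 h3 cremona41067h2 cremona4563b2
    cremona_b2_eq.2.1 cremona_partner_eq.2.1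
  obtain ⟨hr, hb⟩ := bsdp_three_of_thm14 h hCM0 hmod (by norm_num) h9 h3 cremona41067h2
    cremona4563b2 cremona_b2_eq.2.1 cremona_partner_eq.2.1
  exact ⟨hr, hfin, hb⟩

/-- **4563b1** (census record): transported from 4563b2. [cite: HuShuYin2019, Thm. 1.4] [cite: MilneADT2006, Thm. I.7.3] -/
theorem bsdp_three_cremona4563b1 (h : thm14_threePart_product)
    (hCM0 : bsdTriple_of_hasCM_of_L_one_ne_zero) (hmod : hasEntireLFunction_rat)
    (hCassels : bsdRHS_eq_of_isIsogenous) :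
    cremona4563b1.analyticRank = 1 ∧ BSDp cremona4563b1 3 := by
  obtain ⟨hr, hfin, hb⟩ := bsdp_three_cremona4563b2 h hCM0 hmod
  exact bsdp_three_of_isIsogenous hCassels hmod isIsogenous_cremona4563b hr hfin hb

/-- **16641a2** (`E_43`): from Hu–Shu–Yin Thm. 1.4 (`p = 43`) + Burungale–Flach for 449307k2.
[cite: HuShuYin2019, Thm. 1.4] [cite: BurungaleFlach2024, Cor. 2] -/
theorem bsdp_three_cremona16641a2 (h : thm14_threePart_product)
    (hCM0 : bsdTriple_of_hasCM_of_L_one_ne_zero) (hmod : hasEntireLFunction_rat) :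
    cremona16641a2.analyticRank = 1 ∧ Finite cremona16641a2.sha ∧ BSDp cremona16641a2 3 := by
  obtain ⟨-, -, -, -, h9, h3⟩ := hypotheses_seven_thirteen_fortythree
  obtain ⟨-, -, hfin, -⟩ := h 43 (by norm_num) h9 h3 cremona449307k2 cremona16641a2
    cremona_b2_eq.2.2 cremona_partner_eq.2.2
  obtain ⟨hr, hb⟩ := bsdp_three_of_thm14 h hCM0 hmod (by norm_num) h9 h3 cremona449307k2
    cremona16641a2 cremona_b2_eq.2.2 cremona_partner_eq.2.2
  exact ⟨hr, hfin, hb⟩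

/-- **16641a1** (census record): transported from 16641a2. [cite: HuShuYin2019, Thm. 1.4] [cite: MilneADT2006, Thm. I.7.3] -/
theorem bsdp_three_cremona16641a1 (h : thm14_threePart_product)
    (hCM0 : bsdTriple_of_hasCM_of_L_one_ne_zero) (hmod : hasEntireLFunction_rat)
    (hCassels : bsdRHS_eq_of_isIsogenous) :
    cremona16641a1.analyticRank = 1 ∧ BSDp cremona16641a1 3 := by
  obtain ⟨hr, hfin, hb⟩ := bsdp_three_cremona16641a2 h hCM0 hmod
  exact bsdp_three_of_isIsogenous hCassels hmod isIsogenous_cremona16641a hr hfin hb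

/-- **6075bc2** (`E_15`): `r_an = 1 ∧ BSD(E,3)` from Shu–Yin Thm. 1.2 (`p = 5 ≡ 5 mod 9`, pair
`E_{25} × E_{15}`) + Burungale–Flach for 225b2; global minimality of 6075bc2 (`ord₃ Δ = 13`) is the
kernel instance above. [cite: ShuYin2022, Thm. 1.2] [cite: BurungaleFlach2024, Cor. 2] -/
theorem bsdp_three_cremona6075bc2 (h : ShuYin2022.thm12_threePart_product)
    (hCM0 : bsdTriple_of_hasCM_of_L_one_ne_zero) (hmod : hasEntireLFunction_rat) :
    cremona6075bc2.analyticRank = 1 ∧ BSDp cremona6075bc2 3 :=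
  ShuYin2022.bsdp_three_of_thm12_five h hCM0 hmod (by norm_num) (by norm_num) cremona225b2
    cremona6075bc2 cremona_sy_eq.1 cremona_sy_eq.2

/-- **6075bc1** (census record): transported from 6075bc2. Shu–Yin print `|Ш(E_{3p})[3^∞]| = 1`
but not the finiteness of `Ш(E_{3p})`, which Cassels' transport needs; it is supplied by
Gross–Zagier–Kolyvagin at analytic rank `1` (`hGZK`). [cite: ShuYin2022, Thm. 1.2] [cite: MilneADT2006, Thm. I.7.3] [cite: KolyvaginEulerSystems1990] -/
theorem bsdp_three_cremona6075bc1 (h : ShuYin2022.thm12_threePart_product)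
    (hCM0 : bsdTriple_of_hasCM_of_L_one_ne_zero) (hmod : hasEntireLFunction_rat)
    (hCassels : bsdRHS_eq_of_isIsogenous) (hGZK : rank_eq_analyticRank_of_analyticRank_le_one) :
    cremona6075bc1.analyticRank = 1 ∧ BSDp cremona6075bc1 3 := by
  obtain ⟨hr, hb⟩ := bsdp_three_cremona6075bc2 h hCM0 hmod
  have hfin : Finite cremona6075bc2.sha := (hGZK cremona6075bc2 (by rw [hr])).2
  exact bsdp_three_of_isIsogenous hCassels hmod isIsogenous_cremona6075bc hr hfin hb

/-- **Summary (the six census records of R65.3).** Given the three published family theorems,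
Burungale–Flach 2024 Cor. 2, Cassels' isogeny invariance, modularity and Gross–Zagier–Kolyvagin
(all PUBLISHED named facts of the tree), `BSD(E, 3)` holds for the Cremona curves 441b1, 2700h1,
4563b1, 6075bc1, 13068c1, 16641a1 — the census records `(E, 3)` of class X12's cube-sum corner —
with no instance hypothesis and no further input. [cite: KezukaLi2020, Cor. 1.2] [cite: HuShuYin2019, Thm. 1.4] [cite: ShuYin2022, Thm. 1.2] [cite: BurungaleFlach2024, Cor. 2] [cite: MilneADT2006, Thm. I.7.3] -/
theorem bsdp_three_census_records (hKL : KezukaLi2020.cor12_threePart_of_cubeSum)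
    (hHSY : thm14_threePart_product) (hSY : ShuYin2022.thm12_threePart_product)
    (hCM0 : bsdTriple_of_hasCM_of_L_one_ne_zero) (hmod : hasEntireLFunction_rat)
    (hCassels : bsdRHS_eq_of_isIsogenous) (hGZK : rank_eq_analyticRank_of_analyticRank_le_one) :
    BSDp cremona441b1 3 ∧ BSDp cremona2700h1 3 ∧ BSDp cremona4563b1 3 ∧ BSDp cremona6075bc1 3 ∧
      BSDp cremona13068c1 3 ∧ BSDp cremona16641a1 3 :=
  ⟨(bsdp_three_cremona441b1 hHSY hCM0 hmod hCassels).2,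
    (bsdp_three_cremona2700h1 hKL hCassels hmod).2,
    (bsdp_three_cremona4563b1 hHSY hCM0 hmod hCassels).2,
    (bsdp_three_cremona6075bc1 hSY hCM0 hmod hCassels hGZK).2,
    (bsdp_three_cremona13068c1 hKL hCassels hmod).2,
    (bsdp_three_cremona16641a1 hHSY hCM0 hmod hCassels).2⟩

end Literature.NumberTheory.EllipticCurves.Rank1Residual.X12CubeSum

end
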